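import Summits.QuantumFields.BalabanUV.T4Continuum.Support.ShellMeasureBlockWiringUniform
import Summits.QuantumFields.BalabanUV.T4Continuum.Support.ShellMeasureRootCompositionLevelZero

/-!
# `T4Continuum.ShellMeasureBlockWiringCube` — S4 file 3: the consumers' CUBE form of «END-II ⇐ per-bond binders» and the
# S14 → S4 junction (bond read-outs of a holomorphic solution family ARE the per-bond binder)
# (cell `pub-balaban`, sub-cell `t4`, spine estimate NE7c (node U5b); ROUND-2 crew seat `t4-ne7c-formalise-leaf-07`, row S4
# of `t4/b2b-balaban-t4-ne7c-p1/LEAVES-NE7c-P1.md`; ADDITIVE — imports `ShellMeasureBlockWiringUniform` (S4 file 2,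
# p208524; hence file 1 p208247) and leaf-09's `ShellMeasureRootCompositionLevelZero` (the `_cube` END-II) only;
# 0 def, 0 sorry, 0 citations)

HONEST FRAMING.  Finite four-torus programme, rung (B)+1 only — NOT infinite volume, NOT a mass gap, NOT the Clay
problem, NOT summit progress; (B), `BetaPertHyp`, (B^μ) not consumed.  NE7c NOT PRINTED, NOT PROVED; (M1) for Bałaban's
effective measures NOT PRINTED (GAPS G-ne7cp1-1), asserted by nobody.  BOOKKEEPING only («NE7c ⇐ the named binders»,
trigger c3); no `def … : Prop` (c2); nothing instantiated at any live level.  TWO THINGS: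
* §1 THE S14 → S4 JUNCTION.  Row S14 (`ShellMeasureMinimiserBonds`, owner) RE-SOURCES SM-L1: along the contraction ray
  of a window point the localized minimiser is a HOLOMORPHIC SOLUTION FAMILY `σ ↦ X_σ` of B11 Prop. 6's scheme with a
  background family `𝔄_σ`, `‖X_σ‖ ≤ ε₄`, `‖𝔄_σ‖ < a`, flat centre `X_0 = 𝔄_0 = 0`; a bond variable is a READ-OUT.
  Here: for continuous linear read-outs `ℓ_b` (`‖ℓ_b Y‖ ≤ κ‖Y‖`) taken AFTER a holomorphic map `Ψ` on the ball
  `‖Y‖ < ε₄ + a` with `Ψ 0 = 0`, `‖Ψ‖ ≤ ψ̄` there (the linearizing transformation `Y ↦ Y − HD(Y)` of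
  [Balaban1985Variational] (47)/(112)/(174) has this TYPE — crew FINDING F-ne7cleaf02-1; `Ψ = id`, `ψ̄ = ε₄ + a` is the
  linear read-out of S14 v1), the ONE bond family `X x b σ := ℓ_b (Ψ (X_σ + 𝔄_σ))` satisfies file 1's per-bond binder
  (holomorphic on the disc, `≤ κψ̄`, zero at 0) — `bondFn_of_readOut` — hence END-II's `hAN` with `H = e^{4κψ̄} − 1`
  — `hAN_of_readOuts`.  The solution family, `Ψ`, `κ`, `ψ̄` and the holonomy dictionary are displayed BINDERS; S14's
  ∃-output is destructured by the instantiator and fed here BY NAME (no import of S14 needed).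
* §2–§3 THE CUBE FORMS.  Owner's ruling (journal l.6163 (1), on FINDING F-ne7cleaf09-1): END-II's dictionary identities
  `hRdict`/`hudict` are to be asked on the chart cube `[-S,S]ⁿ` only (`…LevelZero.slotAC_realized_su2_of_levelData_cube`);
  all consumers wire to that form.  `slotAC_realized_su2_of_blockBondData_cube` and `…_uniform_cube` are file 1 §3 and
  file 2 §3 with exactly that change (conclusions byte-identical).
* §4 (v1.1) (sk) IN THE MATRIX MODEL.  File 1's weight-side per-bond binder asks, besides (an), the STRUCTURAL triple
  (sk) «`τ (X c) = 0`, `‖exp (±X c)‖ ≤ 1` on `0 ≤ c ≤ 1`»; for `A = M_m(ℂ)` with `τ = Re Tr` (`ShellMeasureWilsonBlock.matrixTrace`)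
  it IS «`X c` skew-Hermitian for real `c`» (Lie-algebra-valued bond variables): `sk_of_skewAdjoint`, and the binder
  producer `hXw_of_skewAdjoint` ((an) + skew-Hermitian values ⟹ file 1's `hX` of `hGW_of_blockBondData` verbatim).
HONEST DEPENDENCY (cell): continuum YM on T⁴ ⇐ BetaPertH ∧ nine spine estimates (0/9 proved); BetaPertH ⇐ (D1) ∧ (D4) ∧
CAP+tail; G-an2-4 gates asym, D1 and NE2/3/4.

WHAT THIS DOES NOT DO.  No estimate; no instance of the solution family, of `Ψ`, of any read-out or dictionary for
Bałaban's minimiser; SM-L2…L8 untouched; NE7c NOT proved; 0/9 spine.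
-/

noncomputable section
open NormedSpace Set Function MeasureTheory Metric

namespace Summit.QuantumFields.BalabanUV.T4Continuum.ShellMeasureBlockWiring

open scoped ENNReal
open Literature.MathematicalPhysics.QuantumFieldTheory.Balaban1983to89
open GaugeField (GaugeInvariant)
open T4ShellMeasure (SlotAntiConcentration)
open T4ShellMeasureFibre (slotAntiConcentration_mono)
open T4CubePoincare (cube)
open T4CubeChartGnomonic (SU2)
open T4CubeChartExp (expWindowDensity expFibreChart)
open T4ShellMeasureDet (blockLaw)
open T4TreeGaugeFixing (NoClosedLoop fixTo)
open ShellMeasureWilsonTrace (TraceData)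
open ShellMeasureLevelAssembly (classifier weight)
open ShellMeasureRootCompositionLevelZero (slotAC_realized_su2_of_levelData_cube)

/-! ## §1 The S14 → S4 junction: bond read-outs of a holomorphic solution family -/

section ReadOuts

variable {𝒴 : Type*} [NormedAddCommGroup 𝒴] [NormedSpace ℂ 𝒴]
variable {A : Type*} [NormedRing A] [NormedAlgebra ℂ A] [CompleteSpace A]

omit [CompleteSpace A] in
/-- **ONE BOND READ-OUT.**  Solution family `Xs` and background family `𝔄f` holomorphic on `ball 0 Rad` with
`‖Xs σ‖ ≤ ε₄`, `‖𝔄f σ‖ < a`, flat centre; `Ψ` holomorphic on `ball 0 (ε₄ + a)` with `Ψ 0 = 0`, `‖Ψ Y‖ ≤ ψ̄` there;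
`ℓ : 𝒴 →L[ℂ] A` with `‖ℓ Y‖ ≤ κ‖Y‖`.  Then `σ ↦ ℓ (Ψ (Xs σ + 𝔄f σ))` is holomorphic on the disc, bounded by `κψ̄`,
and vanishes at `0` — file 1's per-bond binder (an)+(fl). [folklore] -/
theorem bondFn_of_readOut {Rad ε₄ a κ ψb : ℝ} {Xs 𝔄f : ℂ → 𝒴} {Ψ : 𝒴 → 𝒴}
    (hXd : DifferentiableOn ℂ Xs (ball 0 Rad)) (h𝔄d : DifferentiableOn ℂ 𝔄f (ball 0 Rad))
    (hXb : ∀ σ ∈ ball (0 : ℂ) Rad, ‖Xs σ‖ ≤ ε₄) (h𝔄b : ∀ σ ∈ ball (0 : ℂ) Rad, ‖𝔄f σ‖ < a)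
    (hX0 : Xs 0 = 0) (h𝔄0 : 𝔄f 0 = 0)
    (hΨd : DifferentiableOn ℂ Ψ (ball 0 (ε₄ + a))) (hΨ0 : Ψ 0 = 0)
    (hΨb : ∀ Y ∈ ball (0 : 𝒴) (ε₄ + a), ‖Ψ Y‖ ≤ ψb)
    (ℓ : 𝒴 →L[ℂ] A) (hκ : 0 ≤ κ) (hℓ : ∀ Y, ‖ℓ Y‖ ≤ κ * ‖Y‖) :
    DifferentiableOn ℂ (fun σ => ℓ (Ψ (Xs σ + 𝔄f σ))) (ball 0 Rad) ∧
      (∀ w ∈ ball (0 : ℂ) Rad, ‖ℓ (Ψ (Xs w + 𝔄f w))‖ ≤ κ * ψb) ∧ ℓ (Ψ (Xs 0 + 𝔄f 0)) = 0 := by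
  have hmaps : MapsTo (fun σ => Xs σ + 𝔄f σ) (ball (0 : ℂ) Rad) (ball (0 : 𝒴) (ε₄ + a)) := fun σ hσ => by
    rw [mem_ball_zero_iff]
    exact (norm_add_le _ _).trans_lt (add_lt_add_of_le_of_lt (hXb σ hσ) (h𝔄b σ hσ))
  refine ⟨ℓ.differentiable.comp_differentiableOn (hΨd.comp (hXd.add h𝔄d) hmaps), fun w hw => ?_, ?_⟩
  · exact (hℓ _).trans (mul_le_mul_of_nonneg_left (hΨb _ (hmaps hw)) hκ)
  · rw [hX0, h𝔄0, add_zero, hΨ0, map_zero]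

variable {P : Params} {j : ℕ} {E : Type*} [AddCommGroup E] [Module ℝ E]

/-- **JUNCTION S14 → S4 → END-II's `hAN`.**  Per window point `x ∈ W`: a solution family `Xs x`, a background family
`𝔄f x` (S14 §1's ∃-output, destructured), the map `Ψ` and read-outs `ℓ b` (‖ℓ b Y‖ ≤ κ‖Y‖ on the classifier bonds
`Λu`), with the holonomy dictionary «the classifier's plaquette functional along the ray is the plaquette word of the
signed exponentials of the read-outs `ℓ_b (Ψ (Xs x c + 𝔄f x c))`».  CONCLUSION: END-II's binder `hAN` with
`H = e^{4κψ̄} − 1` (`hAN_of_blockBondData` on the bond family `X x b σ := ℓ b (Ψ (Xs x σ + 𝔄f x σ))`). [folklore] -/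
theorem hAN_of_readOuts {W : Set E} {Pu : Finset (Plaq P j)} {Λu : Finset (PBond P j)}
    (hcov : ∀ p ∈ Pu, ∀ bo ∈ plaqOBonds p, bo.1 ∈ Λu) (hol : Plaq P j → E → A)
    {Rad ε₄ a κ ψb : ℝ} (Xs 𝔄f : E → ℂ → 𝒴) (Ψ : 𝒴 → 𝒴)
    (hXd : ∀ x ∈ W, DifferentiableOn ℂ (Xs x) (ball 0 Rad)) (h𝔄d : ∀ x ∈ W, DifferentiableOn ℂ (𝔄f x) (ball 0 Rad))
    (hXb : ∀ x ∈ W, ∀ σ ∈ ball (0 : ℂ) Rad, ‖Xs x σ‖ ≤ ε₄)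
    (h𝔄b : ∀ x ∈ W, ∀ σ ∈ ball (0 : ℂ) Rad, ‖𝔄f x σ‖ < a)
    (hX0 : ∀ x ∈ W, Xs x 0 = 0) (h𝔄0 : ∀ x ∈ W, 𝔄f x 0 = 0)
    (hΨd : DifferentiableOn ℂ Ψ (ball 0 (ε₄ + a))) (hΨ0 : Ψ 0 = 0)
    (hΨb : ∀ Y ∈ ball (0 : 𝒴) (ε₄ + a), ‖Ψ Y‖ ≤ ψb)
    (ℓ : PBond P j → (𝒴 →L[ℂ] A)) (hκ : 0 ≤ κ) (hℓ : ∀ b ∈ Λu, ∀ Y, ‖ℓ b Y‖ ≤ κ * ‖Y‖)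
    (hhol : ∀ x ∈ W, ∀ p ∈ Pu, ∀ c : ℝ, 0 ≤ c → c ≤ 1 →
      hol p (c • x) = exp (ℓ ⟨p.src, p.μ⟩ (Ψ (Xs x c + 𝔄f x c))) *
        exp (ℓ ⟨p.src.shift p.μ, p.ν⟩ (Ψ (Xs x c + 𝔄f x c))) *
        exp (-(ℓ ⟨p.src.shift p.ν, p.μ⟩ (Ψ (Xs x c + 𝔄f x c)))) * exp (-(ℓ ⟨p.src, p.ν⟩ (Ψ (Xs x c + 𝔄f x c))))) :
    ∀ x ∈ W, ∀ p ∈ Pu, ∃ f : ℂ → A, DifferentiableOn ℂ f (ball 0 Rad) ∧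
      (∀ w ∈ ball (0 : ℂ) Rad, ‖f w‖ ≤ Real.exp (4 * (κ * ψb)) - 1) ∧ f 0 = 0 ∧
      ∀ c : ℝ, 0 ≤ c → c ≤ 1 → f (c : ℂ) = hol p (c • x) - 1 :=
  hAN_of_blockBondData hcov hol (fun x b σ => ℓ b (Ψ (Xs x σ + 𝔄f x σ)))
    (fun x hx b hb => bondFn_of_readOut (hXd x hx) (h𝔄d x hx) (hXb x hx) (h𝔄b x hx) (hX0 x hx) (h𝔄0 x hx) hΨd hΨ0
      hΨb (ℓ b) hκ (hℓ b hb))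
    hhol

end ReadOuts

/-! ## §2 END-II ⇐ per-bond binders, dictionary on the chart cube -/

section Cube

variable {P : Params} {j : ℕ} [DecidableEq (PBond P j)]
variable {A : Type*} [NormedRing A] [NormedAlgebra ℂ A] [CompleteSpace A] [NormOneClass A]

/-- **END-II ⇐ PER-BOND BINDERS — DICTIONARY ON THE CHART CUBE** (the consumers' form, owner's ruling l.6163 (1)).
Word for word `slotAC_realized_su2_of_blockBondData` (file 1 §3) EXCEPT that the two DICTIONARY identities `hRdict` ∕
`hudict` are asked for chart points `x ∈ [-S,S]ⁿ` only, and the composition goes through leaf-09's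
`ShellMeasureRootCompositionLevelZero.slotAC_realized_su2_of_levelData_cube` (FINDING F-ne7cleaf09-1: the unrestricted
form is inhabitable only vacuously because the exponential chart is 2π-periodic).  CONCLUSION unchanged:
`SlotAntiConcentration ((fieldMeasure P j SU2).withDensity F) u θ ρ (2(n + β Σ_p L̄_p(d̄_p + 4 s̄_p) + B_𝓔)/(1−δ))`,
`H = e^{4ā} − 1` in (SM).  CONDITIONAL on every binder; nothing PRINTED is asserted; NE7c NOT proved. [folklore] -/
theorem slotAC_realized_su2_of_blockBondData_cube {T : Finset (PBond P j)} (hT : NoClosedLoop T)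
    (U₀ : GaugeField P j SU2) (Λ : Finset (PBond P j)) {n : ℕ} (e : ↥Λ × Fin 3 ≃ Fin n)
    {S : ℝ} (hS : 0 < S) (hSπ : 3 * S ^ 2 < Real.pi ^ 2) (c : GaugeField P j SU2 → GaugeField P j SU2)
    {R : GaugeField P j SU2 → (↥Λ → SU2) → ℝ≥0∞} (hR : ∀ V, Measurable (R V))
    {F : GaugeField P j SU2 → ℝ≥0∞} (hF : Measurable F) (hFi : GaugeInvariant F)
    (hFw : ∀ V y, F (fixTo T U₀ (updateFinset V Λ y)) =
      ENNReal.ofReal (expWindowDensity Λ (c V) S (updateFinset (c V) Λ y)) * R V y)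
    (hfin : ∀ V, ((blockLaw Λ).withDensity fun y => F (fixTo T U₀ (updateFinset V Λ y))) univ ≠ ∞)
    {u : GaugeField P j SU2 → ℝ} (hu : Measurable u) (hui : GaugeInvariant u)  -- level data per exterior section:
    (Ttr : TraceData A) (hN : 0 < Ttr.N) {Pu : Finset (Plaq P j)} (hPu : Pu.Nonempty)
    (hol : GaugeField P j SU2 → Plaq P j → (Fin n → ℝ) → A) (hcont : ∀ V, ∀ p ∈ Pu, Continuous (hol V p))
    (Pw : Finset (Plaq P j)) (G : GaugeField P j SU2 → Plaq P j → (Fin n → ℝ) → A) (𝓔 : GaugeField P j SU2 → (Fin n → ℝ) → ℝ)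
    (W : GaugeField P j SU2 → Set (Fin n → ℝ)) (Jco : GaugeField P j SU2 → (Fin n → ℝ) → ℝ≥0∞)
    {θ δ ρ β Rad ā B𝓔 : ℝ}  -- DICTIONARY (block weight, classifier); SM-L5/L6 kept co-tests (window, centre-monotone):
    (hRdict : ∀ V, ∀ x ∈ cube n S, R V (expFibreChart Λ (c V) e x) = Jco V x * weight Ttr β Pw (G V) (𝓔 V) x)
    (hudict : ∀ V, ∀ x ∈ cube n S,
      u (fixTo T U₀ (updateFinset V Λ (expFibreChart Λ (c V) e x))) = classifier hPu (hol V) x)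
    (hJW : ∀ V x, Jco V x ≠ 0 → x ∈ W V)
    (hJ : ∀ V x, ∀ a : ℝ, 0 ≤ a → Jco V x ≤ Jco V (Real.exp (-a) • x))
    -- THE BLOCK BOND DATA: ONE bond family per (V, x); classifier bonds Λu, moving bonds Λ, frozen exterior letters
    (Λu : Finset (PBond P j)) (hcov : ∀ p ∈ Pu, ∀ bo ∈ plaqOBonds p, bo.1 ∈ Λu)
    (X : GaugeField P j SU2 → (Fin n → ℝ) → PBond P j → ℂ → A)
    (ext : GaugeField P j SU2 → PBond P j → Bool → A) (a d : PBond P j → ℝ) (ha0 : ∀ b, 0 ≤ a b)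
    (hd0 : ∀ b, 0 ≤ d b) (hRad : 1 < Rad)  -- SM-L1 per bond: (an) + (fl) on the classifier bonds, `a_b ≤ ā`:
    (hXu : ∀ V, ∀ x ∈ W V, ∀ b ∈ Λu, DifferentiableOn ℂ (X V x b) (ball 0 Rad) ∧
      (∀ w ∈ ball (0 : ℂ) Rad, ‖X V x b w‖ ≤ a b) ∧ X V x b 0 = 0)
    (hā : ∀ b ∈ Λu, a b ≤ ā)  -- SM-L3 per bond: (an) + (sk) on the moving bonds; frozen exterior letters:
    (hXw : ∀ V, ∀ x ∈ W V, ∀ b ∈ Λ, DifferentiableOn ℂ (X V x b) (ball 0 Rad) ∧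
      (∀ w ∈ ball (0 : ℂ) Rad, ‖X V x b w‖ ≤ a b) ∧
      ∀ c' : ℝ, 0 ≤ c' → c' ≤ 1 → Ttr.τ (X V x b c') = 0 ∧ ‖exp (X V x b c')‖ ≤ 1 ∧ ‖exp (-(X V x b c'))‖ ≤ 1)
    (hext : ∀ V, ∀ p ∈ Pw, ∀ bo ∈ plaqOBonds p, bo.1 ∉ Λ →
      ‖ext V bo.1 bo.2‖ ≤ 1 ∧ ‖ext V bo.1 bo.2 - 1‖ ≤ d bo.1)  -- the two plaquette dictionaries along the ray:
    (hhol : ∀ V, ∀ x ∈ W V, ∀ p ∈ Pu, ∀ c' : ℝ, 0 ≤ c' → c' ≤ 1 →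
      hol V p (c' • x) = exp (X V x ⟨p.src, p.μ⟩ c') * exp (X V x ⟨p.src.shift p.μ, p.ν⟩ c') *
        exp (-(X V x ⟨p.src.shift p.ν, p.μ⟩ c')) * exp (-(X V x ⟨p.src, p.ν⟩ c')))
    (hG : ∀ V, ∀ x ∈ W V, ∀ p ∈ Pw, ∀ c' : ℝ, 0 ≤ c' → c' ≤ 1 →
      G V p (c' • x) = bondFactor Λ (X V x) (ext V) c' (⟨p.src, p.μ⟩, false) *
        bondFactor Λ (X V x) (ext V) c' (⟨p.src.shift p.μ, p.ν⟩, false) *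
        bondFactor Λ (X V x) (ext V) c' (⟨p.src.shift p.ν, p.μ⟩, true) *
        bondFactor Λ (X V x) (ext V) c' (⟨p.src, p.ν⟩, true))
    (hs1 : ∀ p ∈ Pw, movingSize Λ a (plaqOBonds p) ≤ 1)  -- `s̄_p ≤ 1`; then SM-L4, numbers, SM-L2 (`H = e^{4ā} − 1`):
    (hE : ∀ V, ∀ x ∈ W V, ∀ c' : ℝ, 1 / 2 ≤ c' → c' ≤ 1 → 𝓔 V (c' • x) ≤ 𝓔 V x + (1 - c') * B𝓔) (hB𝓔 : 0 ≤ B𝓔)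
    (hθ : 0 < θ) (hδ0 : 0 ≤ δ) (hδ1 : δ < 1) (hρ0 : 0 ≤ ρ) (hρ : ρ ≤ (1 - δ) / 2) (hβ : 0 ≤ β)
    (hSM : 36 * (Real.exp (4 * ā) - 1) * 1 ^ 2 / (Rad - 1) ^ 2 ≤ δ * θ) :
    SlotAntiConcentration ((fieldMeasure P j SU2).withDensity F) u θ ρ
      (2 * ((n : ℝ) + (β * ∑ p ∈ Pw, movingSize Λ (fun b => 3 * a b / (Rad - 1)) (plaqOBonds p) *
        (frozenSize Λ d (plaqOBonds p) + 4 * movingSize Λ a (plaqOBonds p)) + B𝓔)) / (1 - δ)) := by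
  have hL0 : ∀ b, 0 ≤ 3 * a b / (Rad - 1) := fun b => div_nonneg (by linarith [ha0 b]) (by linarith)
  exact slotAC_realized_su2_of_levelData_cube hT U₀ Λ e hS hSπ c hR hF hFi hFw hfin hu hui Ttr hN hPu hol hcont Pw
    G 𝓔 W Jco hRdict hudict hJW hJ hRad
    (fun V => hAN_of_blockBondData (hcov := hcov) (hol V) (X V) (R := Rad) (a := ā)
      (fun x hx b hb => ⟨(hXu V x hx b hb).1, fun w hw => ((hXu V x hx b hb).2.1 w hw).trans (hā b hb),
        (hXu V x hx b hb).2.2⟩) (hhol V))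
    (fun V => hGW_of_blockBondData Ttr hRad Λ (G V) (X V) (ext V) a d (hXw V) (hext V) (hG V))
    hs1 (fun p _ => (sizes_nonneg Λ ha0 hd0 _).1) (fun p _ => (sizes_nonneg Λ hL0 hd0 _).1)
    (fun p _ => (sizes_nonneg Λ ha0 hd0 _).2) hE hB𝓔 hθ hδ0 hδ1 hρ0 hρ hβ hSM

/-! ## §3 … with the LEVEL-ONLY constant -/

/-- **END-II ⇐ PER-BOND BINDERS, LEVEL-ONLY CONSTANT, DICTIONARY ON THE CHART CUBE.**  Word for word
`slotAC_realized_su2_of_blockBondData_uniform` (file 2 §3) with `hRdict` ∕ `hudict` asked on `x ∈ [-S,S]ⁿ` only; constant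
`D̄ = 2(n̄ + β·N̄_w·(12ā/(Rad−1))·(4d̄ + 16ā) + B_𝓔)/(1−δ)` (`slotConst_le_uniform` + `slotAntiConcentration_mono`) — the
form END-I's `hac`/`hDA` and the SEAM (`ShellMeasureRootCompositionSeam`, row S13) consume.  CONDITIONAL on every
binder; nothing PRINTED is asserted; NE7c NOT proved. [folklore] -/
theorem slotAC_realized_su2_of_blockBondData_uniform_cube {T : Finset (PBond P j)} (hT : NoClosedLoop T)
    (U₀ : GaugeField P j SU2) (Λ : Finset (PBond P j)) {n : ℕ} (e : ↥Λ × Fin 3 ≃ Fin n)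
    {S : ℝ} (hS : 0 < S) (hSπ : 3 * S ^ 2 < Real.pi ^ 2) (c : GaugeField P j SU2 → GaugeField P j SU2)
    {R : GaugeField P j SU2 → (↥Λ → SU2) → ℝ≥0∞} (hR : ∀ V, Measurable (R V))
    {F : GaugeField P j SU2 → ℝ≥0∞} (hF : Measurable F) (hFi : GaugeInvariant F)
    (hFw : ∀ V y, F (fixTo T U₀ (updateFinset V Λ y)) =
      ENNReal.ofReal (expWindowDensity Λ (c V) S (updateFinset (c V) Λ y)) * R V y)
    (hfin : ∀ V, ((blockLaw Λ).withDensity fun y => F (fixTo T U₀ (updateFinset V Λ y))) univ ≠ ∞)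
    {u : GaugeField P j SU2 → ℝ} (hu : Measurable u) (hui : GaugeInvariant u)  -- level data per exterior section:
    (Ttr : TraceData A) (hN : 0 < Ttr.N) {Pu : Finset (Plaq P j)} (hPu : Pu.Nonempty)
    (hol : GaugeField P j SU2 → Plaq P j → (Fin n → ℝ) → A) (hcont : ∀ V, ∀ p ∈ Pu, Continuous (hol V p))
    (Pw : Finset (Plaq P j)) (G : GaugeField P j SU2 → Plaq P j → (Fin n → ℝ) → A) (𝓔 : GaugeField P j SU2 → (Fin n → ℝ) → ℝ)
    (W : GaugeField P j SU2 → Set (Fin n → ℝ)) (Jco : GaugeField P j SU2 → (Fin n → ℝ) → ℝ≥0∞)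
    {θ δ ρ β Rad ā dbar B𝓔 nbar Nw : ℝ}  -- DICTIONARY; SM-L5/L6 kept co-tests (window, centre-monotone):
    (hRdict : ∀ V, ∀ x ∈ cube n S, R V (expFibreChart Λ (c V) e x) = Jco V x * weight Ttr β Pw (G V) (𝓔 V) x)
    (hudict : ∀ V, ∀ x ∈ cube n S,
      u (fixTo T U₀ (updateFinset V Λ (expFibreChart Λ (c V) e x))) = classifier hPu (hol V) x)
    (hJW : ∀ V x, Jco V x ≠ 0 → x ∈ W V)
    (hJ : ∀ V x, ∀ a : ℝ, 0 ≤ a → Jco V x ≤ Jco V (Real.exp (-a) • x))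
    -- THE BLOCK BOND DATA (as in file 1) with UNIFORM sizes `a_b ≤ ā` on all bonds, `d_b ≤ d̄`
    (Λu : Finset (PBond P j)) (hcov : ∀ p ∈ Pu, ∀ bo ∈ plaqOBonds p, bo.1 ∈ Λu)
    (X : GaugeField P j SU2 → (Fin n → ℝ) → PBond P j → ℂ → A)
    (ext : GaugeField P j SU2 → PBond P j → Bool → A) (a d : PBond P j → ℝ) (ha0 : ∀ b, 0 ≤ a b)
    (hd0 : ∀ b, 0 ≤ d b) (hā : ∀ b, a b ≤ ā) (hdbar : ∀ b, d b ≤ dbar) (hdb0 : 0 ≤ dbar) (hRad : 1 < Rad)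
    (hXu : ∀ V, ∀ x ∈ W V, ∀ b ∈ Λu, DifferentiableOn ℂ (X V x b) (ball 0 Rad) ∧
      (∀ w ∈ ball (0 : ℂ) Rad, ‖X V x b w‖ ≤ a b) ∧ X V x b 0 = 0)
    (hXw : ∀ V, ∀ x ∈ W V, ∀ b ∈ Λ, DifferentiableOn ℂ (X V x b) (ball 0 Rad) ∧
      (∀ w ∈ ball (0 : ℂ) Rad, ‖X V x b w‖ ≤ a b) ∧
      ∀ c' : ℝ, 0 ≤ c' → c' ≤ 1 → Ttr.τ (X V x b c') = 0 ∧ ‖exp (X V x b c')‖ ≤ 1 ∧ ‖exp (-(X V x b c'))‖ ≤ 1)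
    (hext : ∀ V, ∀ p ∈ Pw, ∀ bo ∈ plaqOBonds p, bo.1 ∉ Λ →
      ‖ext V bo.1 bo.2‖ ≤ 1 ∧ ‖ext V bo.1 bo.2 - 1‖ ≤ d bo.1)
    (hhol : ∀ V, ∀ x ∈ W V, ∀ p ∈ Pu, ∀ c' : ℝ, 0 ≤ c' → c' ≤ 1 →
      hol V p (c' • x) = exp (X V x ⟨p.src, p.μ⟩ c') * exp (X V x ⟨p.src.shift p.μ, p.ν⟩ c') *
        exp (-(X V x ⟨p.src.shift p.ν, p.μ⟩ c')) * exp (-(X V x ⟨p.src, p.ν⟩ c')))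
    (hG : ∀ V, ∀ x ∈ W V, ∀ p ∈ Pw, ∀ c' : ℝ, 0 ≤ c' → c' ≤ 1 →
      G V p (c' • x) = bondFactor Λ (X V x) (ext V) c' (⟨p.src, p.μ⟩, false) *
        bondFactor Λ (X V x) (ext V) c' (⟨p.src.shift p.μ, p.ν⟩, false) *
        bondFactor Λ (X V x) (ext V) c' (⟨p.src.shift p.ν, p.μ⟩, true) *
        bondFactor Λ (X V x) (ext V) c' (⟨p.src, p.ν⟩, true))
    (hs1 : 4 * ā ≤ 1)  -- uniform smallness (⇒ `s̄_p ≤ 1`); uniform geometry; SM-L4; numbers; SM-L2 with `H = e^{4ā} − 1`: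
    (hn : (n : ℝ) ≤ nbar) (hNw : (Pw.card : ℝ) ≤ Nw)
    (hE : ∀ V, ∀ x ∈ W V, ∀ c' : ℝ, 1 / 2 ≤ c' → c' ≤ 1 → 𝓔 V (c' • x) ≤ 𝓔 V x + (1 - c') * B𝓔) (hB𝓔 : 0 ≤ B𝓔)
    (hθ : 0 < θ) (hδ0 : 0 ≤ δ) (hδ1 : δ < 1) (hρ0 : 0 ≤ ρ) (hρ : ρ ≤ (1 - δ) / 2) (hβ : 0 ≤ β)
    (hSM : 36 * (Real.exp (4 * ā) - 1) * 1 ^ 2 / (Rad - 1) ^ 2 ≤ δ * θ) :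
    SlotAntiConcentration ((fieldMeasure P j SU2).withDensity F) u θ ρ
      (2 * (nbar + (β * (Nw * (12 * ā / (Rad - 1) * (4 * dbar + 16 * ā))) + B𝓔)) / (1 - δ)) := by
  have hā0 : 0 ≤ ā := by obtain ⟨p, _⟩ := hPu; exact (ha0 ⟨p.src, p.μ⟩).trans (hā _)
  have h := slotAC_realized_su2_of_blockBondData_cube hT U₀ Λ e hS hSπ c hR hF hFi hFw hfin hu hui Ttr hN hPu hol hcont
    Pw G 𝓔 W Jco hRdict hudict hJW hJ Λu hcov X ext a d ha0 hd0 hRad hXu (fun b _ => hā b) hXw hext hhol hG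
    (fun p _ => ((plaqSizes_le Λ hā0 hdb0 hRad (fun b _ => hā b) (fun b _ => hdbar b) p).1).trans hs1)
    hE hB𝓔 hθ hδ0 hδ1 hρ0 hρ hβ hSM
  exact slotAntiConcentration_mono hρ0
    (slotConst_le_uniform Λ Pw ha0 hd0 hā0 hdb0 hRad hβ hδ1 (fun b _ => hā b) (fun b _ => hdbar b) hn hNw) h

end Cube

/-! ## §4 (v1.1) The weight-side structural triple (sk) in the matrix model: skew-Hermitian bond values -/

section MatrixModel

open scoped Matrix.Norms.L2Operator
open ShellMeasureWilsonBlock (matrixTrace matrixTrace_τ re_trace_eq_zero_of_mem_skewAdjoint)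

variable {m : Type*} [Fintype m] [DecidableEq m] [Nonempty m]

/-- **(sk) FROM SKEW-HERMITIAN VALUES.**  If the bond function takes skew-Hermitian values on the real segment,
`X c ∈ skewAdjoint M_m(ℂ)` for `0 ≤ c ≤ 1`, then `Re Tr (X c) = 0` and `exp (±X c)` are unitary, so of operator norm
`≤ 1` — the triple (sk) of file 1's weight-side per-bond binder for the trace datum `matrixTrace`. [folklore] -/
theorem sk_of_skewAdjoint {X : ℂ → Matrix m m ℂ}
    (hsk : ∀ c : ℝ, 0 ≤ c → c ≤ 1 → X c ∈ skewAdjoint (Matrix m m ℂ)) :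
    ∀ c : ℝ, 0 ≤ c → c ≤ 1 →
      (matrixTrace (n := m)).τ (X c) = 0 ∧ ‖exp (X c)‖ ≤ 1 ∧ ‖exp (-(X c))‖ ≤ 1 := by
  intro c hc0 hc1
  have h := hsk c hc0 hc1
  have hneg : -(X c) ∈ skewAdjoint (Matrix m m ℂ) := (skewAdjoint (Matrix m m ℂ)).neg_mem h
  letI : NormedAlgebra ℚ (Matrix m m ℂ) := NormedAlgebra.restrictScalars ℚ ℂ _
  refine ⟨?_, (CStarRing.norm_coe_unitary ⟨_, exp_mem_unitary_of_mem_skewAdjoint h⟩).le,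
    (CStarRing.norm_coe_unitary ⟨_, exp_mem_unitary_of_mem_skewAdjoint hneg⟩).le⟩
  rw [matrixTrace_τ]
  exact re_trace_eq_zero_of_mem_skewAdjoint h

/-- **THE WEIGHT-SIDE PER-BOND BINDER IN THE MATRIX MODEL.**  (an) `(R, a_b)` on the moving bonds `b ∈ Λ` PLUS
skew-Hermitian values on the real segment ⟹ LITERALLY the per-bond binder `hX` of `hGW_of_blockBondData` (file 1 §2)
for `A = M_m(ℂ)`, `T = matrixTrace`: the structural triple (sk) is discharged, (an) passes through. [folklore] -/
theorem hXw_of_skewAdjoint {ι E : Type*} {W : Set E} {Λ : Finset ι} {X : E → ι → ℂ → Matrix m m ℂ} {R : ℝ}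
    {a : ι → ℝ}
    (han : ∀ x ∈ W, ∀ b ∈ Λ, DifferentiableOn ℂ (X x b) (ball 0 R) ∧ ∀ w ∈ ball (0 : ℂ) R, ‖X x b w‖ ≤ a b)
    (hsk : ∀ x ∈ W, ∀ b ∈ Λ, ∀ c : ℝ, 0 ≤ c → c ≤ 1 → X x b c ∈ skewAdjoint (Matrix m m ℂ)) :
    ∀ x ∈ W, ∀ b ∈ Λ, DifferentiableOn ℂ (X x b) (ball 0 R) ∧ (∀ w ∈ ball (0 : ℂ) R, ‖X x b w‖ ≤ a b) ∧
      ∀ c : ℝ, 0 ≤ c → c ≤ 1 →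
        (matrixTrace (n := m)).τ (X x b c) = 0 ∧ ‖exp (X x b c)‖ ≤ 1 ∧ ‖exp (-(X x b c))‖ ≤ 1 :=
  fun x hx b hb => ⟨(han x hx b hb).1, (han x hx b hb).2, sk_of_skewAdjoint (hsk x hx b hb)⟩

end MatrixModel

end Summit.QuantumFields.BalabanUV.T4Continuum.ShellMeasureBlockWiring
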